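import Mathlib
import Summits.ValiantsHypothesis.ValiantsHypothesis.Theorems.ElementaryWordLengthWordLengthQPStubKappaTwoStructureAux
import Summits.ValiantsHypothesis.ValiantsHypothesis.Theorems.ElementaryWordLengthWordLengthQPStubKappaTwoStructureAuxB
import Summits.ValiantsHypothesis.ValiantsHypothesis.Theorems.ElementaryWordLengthWordLengthQPStubKappaTwoStructureAuxC
import Summits.ValiantsHypothesis.ValiantsHypothesis.Theorems.ElementaryWordLengthWordLengthQPStubKappaTwoStructureAuxD

/-!
# Crux `WordLengthQP` (stmt-ValiantsHypothesis-6623), line `positive-monoid-exits` —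
helpers for stub `stub_kappaTwoStructure`, part E: real (skeleton) bookkeeping and the KEY
inequality of the `(y₁, x₁)` family.

* entrywise nonnegativity of skeleton stretches (`k2r_*`);
* block-`{0,1}` matrices `BLK`/`TNB` (written out as conjunctions, no definitions);
* `k2_key_I`: for a real loop `P̄₀ y₁(a) Q̄ x₁(b) P̄₂ = 1` whose three stretches are products of
  block-`{0,1}` totally nonnegative unipotent letters, `(P̄₂ · Ḡ)₁₁ ≥ 1` for EVERY prefix `Ḡ`
  of the loop (three phases: inside `P̄₀` by positivity, inside `Q̄` and inside `P̄₂` by the two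
  rotations of the loop) — the closed form of the winding obstruction.
-/

set_option linter.dupNamespace false

noncomputable section

namespace Summit.ValiantsHypothesis.ValiantsHypothesis.Cruxes.WordLengthQP.PositiveMonoidExits

open MvPolynomial

/-! ## Real entrywise bookkeeping for skeleton stretches -/

/-- Products of entrywise-nonnegative real `3 × 3` matrices are entrywise nonnegative. [folklore] -/
theorem k2r_mul_nonneg {M N : Matrix (Fin 3) (Fin 3) ℝ} (hM : ∀ i j, 0 ≤ M i j)
    (hN : ∀ i j, 0 ≤ N i j) (i j : Fin 3) : 0 ≤ (M * N) i j := by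
  rw [Matrix.mul_apply]
  exact Finset.sum_nonneg fun k _ => mul_nonneg (hM i k) (hN k j)

/-- If `T - 1 ≥ 0` entrywise for every `T` in a list then `∏ T - 1 ≥ 0` entrywise. [folklore] -/
theorem k2r_prod_sub_one_nonneg (Ts : List (Matrix (Fin 3) (Fin 3) ℝ))
    (h : ∀ T ∈ Ts, ∀ i j, 0 ≤ (T - 1) i j) : ∀ i j, 0 ≤ (Ts.prod - 1) i j := by
  refine List.prod_induction (fun T : Matrix (Fin 3) (Fin 3) ℝ => ∀ i j, 0 ≤ (T - 1) i j) ?_ ?_ h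
  · intro A B hA hB i j
    have hAB : A * B - 1 = (A - 1) * (B - 1) + (A - 1) + (B - 1) := by noncomm_ring
    rw [hAB, Matrix.add_apply, Matrix.add_apply]
    exact add_nonneg (add_nonneg (k2r_mul_nonneg hA hB i j) (hA i j)) (hB i j)
  · intro i j; simp

/-- `∏ T - 1` dominates each `T - 1` entrywise (all `T - 1 ≥ 0`). [folklore] -/
theorem k2r_mem_le_prod_sub_one (Ts : List (Matrix (Fin 3) (Fin 3) ℝ))
    (h : ∀ T ∈ Ts, ∀ i j, 0 ≤ (T - 1) i j) (T : Matrix (Fin 3) (Fin 3) ℝ) (hT : T ∈ Ts)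
    (i j : Fin 3) : (T - 1) i j ≤ (Ts.prod - 1) i j := by
  obtain ⟨A, B, rfl⟩ := List.append_of_mem hT
  have hA := k2r_prod_sub_one_nonneg A (fun U hU => h U (by simp [hU]))
  have hB := k2r_prod_sub_one_nonneg B (fun U hU => h U (by simp [hU]))
  have hT1 := h T hT
  rw [List.prod_append, List.prod_cons]
  have hdec : A.prod * (T * B.prod) - 1 = (T - 1) + ((A.prod - 1) * (T - 1) * (B.prod - 1) +
      (A.prod - 1) * (T - 1) + (T - 1) * (B.prod - 1) + (A.prod - 1) * (B.prod - 1) +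
      (A.prod - 1) + (B.prod - 1)) := by noncomm_ring
  rw [hdec, Matrix.add_apply, le_add_iff_nonneg_right]
  simp only [Matrix.add_apply]
  refine add_nonneg (add_nonneg (add_nonneg (add_nonneg (add_nonneg ?_ ?_) ?_) ?_) (hA i j)) (hB i j)
  · exact k2r_mul_nonneg (k2r_mul_nonneg hA hT1) hB i j
  · exact k2r_mul_nonneg hA hT1 i j
  · exact k2r_mul_nonneg hT1 hB i j
  · exact k2r_mul_nonneg hA hB i j

/-- The skeleton of a tame letter is `1 +` (entrywise nonnegative). [folklore] -/
theorem k2r_tame_sub_one_nonneg {σ : Type} (l : Fin 3 × Fin 3 × ℝ × Option σ) (h : ((0 < Prod.fst (Prod.snd (Prod.snd l)) ∧ (Fin.val (Prod.fst l) + 1 = Fin.val (Prod.fst (Prod.snd l)) ∨ Fin.val (Prod.fst (Prod.snd l)) + 1 = Fin.val (Prod.fst l))) ∨ Prod.fst (Prod.snd (Prod.snd l)) = 0))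
    (i j : Fin 3) : 0 ≤ ((Matrix.transvection (Prod.fst l) (Prod.fst (Prod.snd l)) (Option.elim (Prod.snd (Prod.snd (Prod.snd l))) (Prod.fst (Prod.snd (Prod.snd l))) (fun _ => (0 : ℝ))) : Matrix (Fin 3) (Fin 3) ℝ) - 1) i j := by
  have hc : 0 ≤ l.2.2.1 := by
    rcases h with ⟨h1, -⟩ | h0
    · exact h1.le
    · exact h0.ge
  simp only [Matrix.transvection, add_sub_cancel_left, Matrix.single_apply]
  split_ifs
  · rcases l with ⟨a, b, c, _ | v⟩
    · exact hc
    · simp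
  · exact le_rfl

/-- The skeleton of a constant letter `E_ij(c)` carries `c` at `(i, j)`. [folklore] -/
theorem k2r_letter_sub_one_apply_self {σ : Type} (l : Fin 3 × Fin 3 × ℝ × Option σ)
    (ho : l.2.2.2 = none) : ((Matrix.transvection (Prod.fst l) (Prod.fst (Prod.snd l)) (Option.elim (Prod.snd (Prod.snd (Prod.snd l))) (Prod.fst (Prod.snd (Prod.snd l))) (fun _ => (0 : ℝ))) : Matrix (Fin 3) (Fin 3) ℝ) - 1) l.1 l.2.1 = l.2.2.1 := by
  simp [Matrix.transvection, ho]

/-- A tame stretch whose skeleton product has `(i, j)` entry `≤ 0` (`i ≠ j`) has no CONSTANT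
letter of type `(i, j)` with positive coefficient. [folklore] -/
theorem k2r_no_const_letter {σ : Type} (q : List (Fin 3 × Fin 3 × ℝ × Option σ))
    (hq : ∀ l ∈ q, ((0 < Prod.fst (Prod.snd (Prod.snd l)) ∧ (Fin.val (Prod.fst l) + 1 = Fin.val (Prod.fst (Prod.snd l)) ∨ Fin.val (Prod.fst (Prod.snd l)) + 1 = Fin.val (Prod.fst l))) ∨ Prod.fst (Prod.snd (Prod.snd l)) = 0)) (i j : Fin 3) (hij : i ≠ j)
    (hle : ((q.map (fun l => (Matrix.transvection (Prod.fst l) (Prod.fst (Prod.snd l)) (Option.elim (Prod.snd (Prod.snd (Prod.snd l))) (Prod.fst (Prod.snd (Prod.snd l))) (fun _ => (0 : ℝ))) : Matrix (Fin 3) (Fin 3) ℝ))).prod) i j ≤ 0) :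
    ∀ l ∈ q, l.2.2.2 = none → l.1 = i → l.2.1 = j → l.2.2.1 = 0 := by
  intro l hl ho hi hj
  rcases hq l hl with ⟨hc, -⟩ | h0
  · exfalso
    have hmem : (Matrix.transvection (Prod.fst l) (Prod.fst (Prod.snd l)) (Option.elim (Prod.snd (Prod.snd (Prod.snd l))) (Prod.fst (Prod.snd (Prod.snd l))) (fun _ => (0 : ℝ))) : Matrix (Fin 3) (Fin 3) ℝ) ∈ q.map (fun l => (Matrix.transvection (Prod.fst l) (Prod.fst (Prod.snd l)) (Option.elim (Prod.snd (Prod.snd (Prod.snd l))) (Prod.fst (Prod.snd (Prod.snd l))) (fun _ => (0 : ℝ))) : Matrix (Fin 3) (Fin 3) ℝ)) := List.mem_map_of_mem hl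
    have key := k2r_mem_le_prod_sub_one (q.map (fun l => (Matrix.transvection (Prod.fst l) (Prod.fst (Prod.snd l)) (Option.elim (Prod.snd (Prod.snd (Prod.snd l))) (Prod.fst (Prod.snd (Prod.snd l))) (fun _ => (0 : ℝ))) : Matrix (Fin 3) (Fin 3) ℝ))) (fun T hT => by
      obtain ⟨l', hl', rfl⟩ := List.mem_map.1 hT
      exact k2r_tame_sub_one_nonneg l' (hq l' hl')) _ hmem i j
    subst hi; subst hj
    rw [k2r_letter_sub_one_apply_self l ho, Matrix.sub_apply, Matrix.one_apply_ne hij,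
      sub_zero] at key
    linarith
  · exact h0

/-! ## Block-`{0,1}` matrices -/

/-- Block-`{0,1}` totally nonnegative unipotent-type matrices are closed under products
(`TNB` is spelled out: third row/column trivial, entries `≥ 0`, diagonal `≥ 1`, `2 × 2`
determinant `1`). [folklore] -/
theorem k2_tnb_mul (G H : Matrix (Fin 3) (Fin 3) ℝ)
    (hG : G 0 2 = 0 ∧ G 1 2 = 0 ∧ G 2 0 = 0 ∧ G 2 1 = 0 ∧ G 2 2 = 1 ∧ 0 ≤ G 0 1 ∧ 0 ≤ G 1 0 ∧
      1 ≤ G 0 0 ∧ 1 ≤ G 1 1 ∧ G 0 0 * G 1 1 - G 0 1 * G 1 0 = 1)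
    (hH : H 0 2 = 0 ∧ H 1 2 = 0 ∧ H 2 0 = 0 ∧ H 2 1 = 0 ∧ H 2 2 = 1 ∧ 0 ≤ H 0 1 ∧ 0 ≤ H 1 0 ∧
      1 ≤ H 0 0 ∧ 1 ≤ H 1 1 ∧ H 0 0 * H 1 1 - H 0 1 * H 1 0 = 1) :
    (G * H) 0 2 = 0 ∧ (G * H) 1 2 = 0 ∧ (G * H) 2 0 = 0 ∧ (G * H) 2 1 = 0 ∧ (G * H) 2 2 = 1 ∧
      0 ≤ (G * H) 0 1 ∧ 0 ≤ (G * H) 1 0 ∧ 1 ≤ (G * H) 0 0 ∧ 1 ≤ (G * H) 1 1 ∧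
      (G * H) 0 0 * (G * H) 1 1 - (G * H) 0 1 * (G * H) 1 0 = 1 := by
  obtain ⟨g02, g12, g20, g21, g22, g01, g10, g00, g11, gd⟩ := hG
  obtain ⟨h02, h12, h20, h21, h22, h01, h10, h00, h11, hd⟩ := hH
  simp only [Matrix.mul_apply, Fin.sum_univ_three, g02, g12, g20, g21, g22, h02, h12, h20, h21, h22,
    mul_zero, zero_mul, add_zero, zero_add, mul_one]
  refine ⟨trivial, trivial, trivial, trivial, trivial, by positivity, by positivity, ?_, ?_, ?_⟩
  · nlinarith [mul_nonneg g01 h10]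
  · nlinarith [mul_nonneg g10 h01]
  · linear_combination (H 0 0 * H 1 1 - H 0 1 * H 1 0) * gd + hd

/-- Products of lists of `TNB` matrices are `TNB`. [folklore] -/
theorem k2_tnb_prod (Ts : List (Matrix (Fin 3) (Fin 3) ℝ))
    (h : ∀ G ∈ Ts, G 0 2 = 0 ∧ G 1 2 = 0 ∧ G 2 0 = 0 ∧ G 2 1 = 0 ∧ G 2 2 = 1 ∧ 0 ≤ G 0 1 ∧
      0 ≤ G 1 0 ∧ 1 ≤ G 0 0 ∧ 1 ≤ G 1 1 ∧ G 0 0 * G 1 1 - G 0 1 * G 1 0 = 1) :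
    Ts.prod 0 2 = 0 ∧ Ts.prod 1 2 = 0 ∧ Ts.prod 2 0 = 0 ∧ Ts.prod 2 1 = 0 ∧ Ts.prod 2 2 = 1 ∧
      0 ≤ Ts.prod 0 1 ∧ 0 ≤ Ts.prod 1 0 ∧ 1 ≤ Ts.prod 0 0 ∧ 1 ≤ Ts.prod 1 1 ∧
      Ts.prod 0 0 * Ts.prod 1 1 - Ts.prod 0 1 * Ts.prod 1 0 = 1 := by
  induction Ts with
  | nil => simp
  | cons T Ts ih =>
    rw [List.prod_cons]
    exact k2_tnb_mul T Ts.prod (h T (by simp)) (ih fun G hG => h G (by simp [hG]))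

/-- Block-`{0,1}` shape (`BLK`: third row and column trivial) is closed under products. [folklore] -/
theorem k2_blk_mul (G H : Matrix (Fin 3) (Fin 3) ℝ)
    (hG : G 0 2 = 0 ∧ G 1 2 = 0 ∧ G 2 0 = 0 ∧ G 2 1 = 0 ∧ G 2 2 = 1)
    (hH : H 0 2 = 0 ∧ H 1 2 = 0 ∧ H 2 0 = 0 ∧ H 2 1 = 0 ∧ H 2 2 = 1) :
    (G * H) 0 2 = 0 ∧ (G * H) 1 2 = 0 ∧ (G * H) 2 0 = 0 ∧ (G * H) 2 1 = 0 ∧ (G * H) 2 2 = 1 := by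
  obtain ⟨g02, g12, g20, g21, g22⟩ := hG
  obtain ⟨h02, h12, h20, h21, h22⟩ := hH
  simp [Matrix.mul_apply, Fin.sum_univ_three, g02, g12, g20, g21, g22, h02, h12, h20, h21, h22]

/-- Products of lists of `BLK` matrices are `BLK`. [folklore] -/
theorem k2_blk_prod (Ts : List (Matrix (Fin 3) (Fin 3) ℝ))
    (h : ∀ G ∈ Ts, G 0 2 = 0 ∧ G 1 2 = 0 ∧ G 2 0 = 0 ∧ G 2 1 = 0 ∧ G 2 2 = 1) :
    Ts.prod 0 2 = 0 ∧ Ts.prod 1 2 = 0 ∧ Ts.prod 2 0 = 0 ∧ Ts.prod 2 1 = 0 ∧ Ts.prod 2 2 = 1 := by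
  induction Ts with
  | nil => simp
  | cons T Ts ih =>
    rw [List.prod_cons]
    exact k2_blk_mul T Ts.prod (h T (by simp)) (ih fun G hG => h G (by simp [hG]))

/-- `x₁(t) = E₀₁(t)` and `y₁(t) = E₁₀(t)` are `BLK` (any `t`). [folklore] -/
theorem k2_blk_letter (t : ℝ) :
    ((Matrix.transvection (0 : Fin 3) 1 t) 0 2 = 0 ∧ (Matrix.transvection (0 : Fin 3) 1 t) 1 2 = 0 ∧
      (Matrix.transvection (0 : Fin 3) 1 t) 2 0 = 0 ∧ (Matrix.transvection (0 : Fin 3) 1 t) 2 1 = 0 ∧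
      (Matrix.transvection (0 : Fin 3) 1 t) 2 2 = 1) ∧
    ((Matrix.transvection (1 : Fin 3) 0 t) 0 2 = 0 ∧ (Matrix.transvection (1 : Fin 3) 0 t) 1 2 = 0 ∧
      (Matrix.transvection (1 : Fin 3) 0 t) 2 0 = 0 ∧ (Matrix.transvection (1 : Fin 3) 0 t) 2 1 = 0 ∧
      (Matrix.transvection (1 : Fin 3) 0 t) 2 2 = 1) := by
  constructor <;> simp [Matrix.transvection]

/-- `x₁(t)`, `y₁(t)` with `t ≥ 0`, and `1`, are `TNB`. [folklore] -/
theorem k2_tnb_letter (t : ℝ) (ht : 0 ≤ t) (G : Matrix (Fin 3) (Fin 3) ℝ)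
    (hG : G = 1 ∨ G = Matrix.transvection 0 1 t ∨ G = Matrix.transvection 1 0 t) :
    G 0 2 = 0 ∧ G 1 2 = 0 ∧ G 2 0 = 0 ∧ G 2 1 = 0 ∧ G 2 2 = 1 ∧ 0 ≤ G 0 1 ∧ 0 ≤ G 1 0 ∧
      1 ≤ G 0 0 ∧ 1 ≤ G 1 1 ∧ G 0 0 * G 1 1 - G 0 1 * G 1 0 = 1 := by
  rcases hG with rfl | rfl | rfl
  · simp
  · simp [Matrix.transvection, ht]
  · simp [Matrix.transvection, ht]

/-- Inverse of a block matrix with determinant `1`: if `N M = 1` then `M₁₁ = N₀₀`. [folklore] -/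
theorem k2_inv11 (N M : Matrix (Fin 3) (Fin 3) ℝ)
    (hN : N 0 2 = 0 ∧ N 1 2 = 0 ∧ N 2 0 = 0 ∧ N 2 1 = 0 ∧ N 2 2 = 1)
    (hdet : N 0 0 * N 1 1 - N 0 1 * N 1 0 = 1) (h : N * M = 1) : M 1 1 = N 0 0 := by
  obtain ⟨n02, n12, -, -, -⟩ := hN
  have e01 := congrArg (fun X : Matrix (Fin 3) (Fin 3) ℝ => X 0 1) h
  have e11 := congrArg (fun X : Matrix (Fin 3) (Fin 3) ℝ => X 1 1) h
  simp only [Matrix.mul_apply, Fin.sum_univ_three, n02, n12, zero_mul, add_zero,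
    Matrix.one_apply] at e01 e11
  simp at e01 e11
  linear_combination (-(N 1 0)) * e01 + N 0 0 * e11 - M 1 1 * hdet

/-! ## The KEY inequality of the `(y₁, x₁)` family -/

/-- **KEY (family `(y₁,x₁)`).** Let `P̄₀ y₁(a) Q̄ x₁(b) P̄₂ = 1` with `P̄₀, Q̄, P̄₂` products of
lists of `TNB` matrices (`a`, `b` arbitrary reals, `y₁ = E₁₀`, `x₁ = E₀₁`).  Then for every
prefix `Ḡ` of the loop, `(P̄₂ Ḡ)₁₁ ≥ 1`:
inside `P̄₀` by positivity; inside `Q̄` because `P̄₂ P̄₀ y₁(a) Q̄_{≤k} = x₁(-b) (Q̄_{>k})⁻¹`;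
inside `P̄₂` because `P̄₂ Ḡ = P̄₂_{≤k}`. [folklore] -/
theorem k2_key_I (P0 Q P2 : List (Matrix (Fin 3) (Fin 3) ℝ)) (a b : ℝ)
    (hT : ∀ G ∈ P0 ++ Q ++ P2, G 0 2 = 0 ∧ G 1 2 = 0 ∧ G 2 0 = 0 ∧ G 2 1 = 0 ∧ G 2 2 = 1 ∧
      0 ≤ G 0 1 ∧ 0 ≤ G 1 0 ∧ 1 ≤ G 0 0 ∧ 1 ≤ G 1 1 ∧ G 0 0 * G 1 1 - G 0 1 * G 1 0 = 1)
    (hloop : P0.prod * (Matrix.transvection 1 0 a * (Q.prod * (Matrix.transvection 0 1 b *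
      P2.prod))) = 1) :
    (∀ A B : List (Matrix (Fin 3) (Fin 3) ℝ), P0 = A ++ B → 1 ≤ (P2.prod * A.prod : Matrix (Fin 3) (Fin 3) ℝ) 1 1) ∧
    (∀ A B : List (Matrix (Fin 3) (Fin 3) ℝ), Q = A ++ B →
      1 ≤ (P2.prod * (P0.prod * (Matrix.transvection 1 0 a * A.prod)) : Matrix (Fin 3) (Fin 3) ℝ) 1 1) ∧
    (∀ A B : List (Matrix (Fin 3) (Fin 3) ℝ), P2 = A ++ B →
      1 ≤ (P2.prod * (P0.prod * (Matrix.transvection 1 0 a * (Q.prod *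
        (Matrix.transvection 0 1 b * A.prod)))) : Matrix (Fin 3) (Fin 3) ℝ) 1 1) := by
  have hP0 : ∀ G ∈ P0, _ := fun G hG => hT G (by simp [hG])
  have hQ : ∀ G ∈ Q, _ := fun G hG => hT G (by simp [hG])
  have hP2 : ∀ G ∈ P2, _ := fun G hG => hT G (by simp [hG])
  have tP2 := k2_tnb_prod P2 hP2
  refine ⟨fun A B hAB => ?_, fun A B hAB => ?_, fun A B hAB => ?_⟩
  · -- phase (a): positivity
    subst hAB
    have tA := k2_tnb_prod A fun G hG => hP0 G (by simp [hG])
    exact (k2_tnb_mul _ _ tP2 tA).2.2.2.2.2.2.2.2.1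
  · -- phase (b): P2 P0 y A = x₁(-b)-twisted inverse of B, (1,1) entry = B₀₀
    subst hAB
    have tB := k2_tnb_prod B fun G hG => hQ G (by simp [hG])
    rw [List.prod_append] at hloop
    -- N := B.prod * x₁(b);  N * (P2 (P0 y A)) = 1
    set M := P2.prod * (P0.prod * (Matrix.transvection 1 0 a * A.prod)) with hM
    have h1 : (P0.prod * (Matrix.transvection 1 0 a * A.prod)) *
        (B.prod * (Matrix.transvection 0 1 b * P2.prod)) = 1 := by
      simpa only [Matrix.mul_assoc] using hloop
    have h2 : (B.prod * (Matrix.transvection 0 1 b * P2.prod)) *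
        (P0.prod * (Matrix.transvection 1 0 a * A.prod)) = 1 := mul_eq_one_comm.mp h1
    have h3 : (B.prod * Matrix.transvection 0 1 b) * M = 1 := by
      rw [hM]; simpa only [Matrix.mul_assoc] using h2
    set N : Matrix (Fin 3) (Fin 3) ℝ := B.prod * Matrix.transvection 0 1 b with hNdef
    have hN : N 0 2 = 0 ∧ N 1 2 = 0 ∧ N 2 0 = 0 ∧ N 2 1 = 0 ∧ N 2 2 = 1 :=
      k2_blk_mul _ _ ⟨tB.1, tB.2.1, tB.2.2.1, tB.2.2.2.1, tB.2.2.2.2.1⟩ (k2_blk_letter b).1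
    have hdet : N 0 0 * N 1 1 - N 0 1 * N 1 0 = 1 := by
      rw [hNdef, Matrix.mul_transvection_apply_same, Matrix.mul_transvection_apply_same,
        Matrix.mul_transvection_apply_of_ne _ _ _ _ (by decide),
        Matrix.mul_transvection_apply_of_ne _ _ _ _ (by decide)]
      linear_combination tB.2.2.2.2.2.2.2.2.2
    have := k2_inv11 _ _ hN hdet h3
    rw [this, hNdef, Matrix.mul_transvection_apply_of_ne _ _ _ _ (by decide)]
    exact tB.2.2.2.2.2.2.2.1
  · -- phase (c): P2 * G = A.prod
    subst hAB
    have tA := k2_tnb_prod A fun G hG => hP2 G (by simp [hG])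
    rw [List.prod_append] at hloop ⊢
    set G := P0.prod * (Matrix.transvection 1 0 a * (Q.prod * (Matrix.transvection 0 1 b * A.prod)))
      with hG
    have h1 : G * B.prod = 1 := by
      rw [hG]; simpa only [Matrix.mul_assoc] using hloop
    have h2 : B.prod * G = 1 := mul_eq_one_comm.mp h1
    have : A.prod * B.prod * G = A.prod := by rw [Matrix.mul_assoc, h2, Matrix.mul_one]
    rw [this]
    exact tA.2.2.2.2.2.2.2.2.1

end Summit.ValiantsHypothesis.ValiantsHypothesis.Cruxes.WordLengthQP.PositiveMonoidExits

end
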